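import Summits.CriticalPhenomena.PercolationContinuityZ3.Theorems.Transplant.KNLevelsTargetPropertyAdditive
import HarnessLib

/-!
# F6/F7 (generic), (S0) kit tier part 1 — the RELAY CLAUSE of a level kit, the bundle `TStep.KitsAtF`, the source-additive target
# property `AdditiveTargetPropertyUF` over it, its additive chains, and the bridge from Kozma–Nitzan's kits (N2-SCOPE §19.1 (d); T4-S0 v1.1)

builds on p205010 (kernel theorem, internal audit signed; external expert review pending) — nothing in this file uses p205010; nothing
here is a claim about the open node `SamePDropOfSkeletonFrm₁`.
Lane `prim-bschramm`, seat `prim-bschramm-p1` (gen 16; (S0) kit tier, WAVE 0 (d)); helper file (`--supports stmt-CriticalPhenomena-4575`).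

WHY.  Kozma–Nitzan's Step V (part 3 `LHyp.stepV_in`, part 7a `LHyp.stepV_additive`) reads the per-level kit through THREE clauses — the
seeds avoid the pairs inside the shell `S` (`hSseed`), the faces lie in `S`, and the Step-IV face estimate `hIV` — and uses the first only
to get `P_{K_ξ}(F_x) = P(F_x)` (Claim D).  In the (S0) kit tier ('force the kit's own seed box', T4-S0) the seed of a contact CONTAINS the
edges of its relay box, which lies in `S`, so `hSseed` fails by design.  What Step V actually consumes is the conclusion of Claim D; this
file makes it the interface:

* the **relay clause** (V*) of seed data `σ` with shell `S` at accuracy `δ`: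
  `P(Failᶜ ∩ 𝒢) − 3δ ≤ P(⋃_{x ∈ K} oSeed x ∩ {ω | some u ∈ face x has P(u ↔ T inside D | ω|_{E(S)}) > 1 − δ})`
  ("with probability ≥ P(≥ N contacts, 𝒢) − 3δ some selected contact has an open seed AND a good relay in its face", KN p. 21 (26));
* `TStep.KitsAtF` = `TStep.KitsAt` with (`hSseed`, `S ⊆ B⟨j⟩`, `hIV`) replaced by (V*) (faces ⊆ `S ⊆ D` kept), `KitsAtF.mono`;
* `AdditiveTargetPropertyUF V Δ` = part 5's `AdditiveTargetPropertyUP` over the relay clause, with the bookkeeping corollaries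
  `apply_step` / `chain_edge_additive` / `chain_edge_from_source` (proofs verbatim from part 5);
* **the bridge** `TStep.KitsAt.toF`: Kozma–Nitzan kits ARE (S0)-shape kits (Claim D's independence half: `F_x ⟂ E(S)`), so every producer of
  the old bundle feeds the new chains, and `AdditiveTargetPropertyUF V Δ → AdditiveTargetPropertyUP V Δ`.
Part 2 (`KNLevelsStepVForced`) proves Step V / Lemma 10 / the property unconditionally over (V*); part 3 (`KNLevelsRelayForced`) produces (V*)
for forced kits (Step IV″: Markov over the shell pairs + the rank-truncation bound, no avoidance row).
[cite: KozmaNitzan2024, §4 Lemma 10 (pp. 17–22: Steps III–V, (19), (26)), Lemma 11 (p. 22), Lemma 12 (pp. 23–25)] [this work]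
-/

noncomputable section

open MeasureTheory ProbabilityTheory
open scoped ENNReal

namespace Summit.CriticalPhenomena.PercolationContinuityZ3.Theorems

namespace Transplant

namespace KNLevels

open Literature.Probability.Percolation Literature.Probability.LatticeModels SimpleGraph

/-! ## §1 The relay clause and the bundle `KitsAtF` -/

section Relay

variable {V : Type*} [DecidableEq V] {G : SimpleGraph V} [G.LocallyFinite]

/-- **The good-relay event of a contact `x`** for seed data `σ`, shell `S`, target `T`, region `D`, weighting `W`, accuracy `δ`: some vertex of
the face behind `x` is joined to `T` inside `D` with conditional probability `> 1 − δ` given the states of the pairs inside `S`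
(KN p. 21: "`U(P) ∩ A_ξ ≠ ∅`"). [cite: KozmaNitzan2024, §4 p. 21 (the set A_ξ, (24)–(25))] -/
def GoodFace (W : Sym2 V → unitInterval) (σ : SData V) (S T D : Finset V) (δ : ℝ) (x : V) : Set (BondConfig V) :=
  {ω | ∃ u ∈ σ.face x, 1 - δ < (prodBernoulli (pinW W (wireSet (↑S : Set V)) ω)).real (⋃ t ∈ T, openConnIn (↑D : Set V) u t)}

omit [DecidableEq V] [G.LocallyFinite] in
/-- Membership in `GoodFace`. [folklore] -/
theorem mem_goodFace_iff {W : Sym2 V → unitInterval} {σ : SData V} {S T D : Finset V} {δ : ℝ} {x : V} {ω : BondConfig V} :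
    ω ∈ GoodFace W σ S T D δ x ↔
      ∃ u ∈ σ.face x, 1 - δ < (prodBernoulli (pinW W (wireSet (↑S : Set V)) ω)).real (⋃ t ∈ T, openConnIn (↑D : Set V) u t) :=
  Iff.rfl

omit [G.LocallyFinite] in
/-- `GoodFace` only depends on the pattern of `ω` on the pairs inside `S`. [folklore] -/
theorem determinedBy_goodFace (W : Sym2 V → unitInterval) (σ : SData V) (S T D : Finset V) (δ : ℝ) (x : V) :
    DeterminedBy (GoodFace W σ S T D δ x) (↑(pairsF S) : Set (Sym2 V)) := by
  rw [determinedBy_iff]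
  intro ω ω' hω
  simp only [mem_goodFace_iff]
  have hag : ∀ e ∈ wireSet (↑S : Set V), e ∈ ω ↔ e ∈ ω' := by
    intro e he
    rw [← coe_pairsF] at he
    have := Set.ext_iff.1 hω e
    simp only [Set.mem_inter_iff] at this
    exact ⟨fun h' => (this.1 ⟨h', he⟩).1, fun h' => (this.2 ⟨h', he⟩).1⟩
  refine exists_congr fun u => and_congr_right fun _ => ?_
  rw [pinW_congr W hag]

omit [G.LocallyFinite] in
/-- `GoodFace` is measurable. [folklore] -/
theorem measurableSet_goodFace (W : Sym2 V → unitInterval) (σ : SData V) (S T D : Finset V) (δ : ℝ) (x : V) :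
    MeasurableSet (GoodFace W σ S T D δ x) :=
  (determinedBy_goodFace W σ S T D δ x).measurableSet_of_finset

omit [DecidableEq V] [G.LocallyFinite] in
/-- `GoodFace` is monotone in the accuracy. [folklore] -/
theorem goodFace_mono (W : Sym2 V → unitInterval) (σ : SData V) (S T D : Finset V) {δ δ' : ℝ} (h : δ ≤ δ') (x : V) :
    GoodFace W σ S T D δ x ⊆ GoodFace W σ S T D δ' x := by
  rintro ω ⟨u, hu, hω⟩
  exact ⟨u, hu, lt_of_le_of_lt (by linarith) hω⟩

/-- **The RELAY CLAUSE of a level kit** (seed data `σ` at level `j` of `L`, shell `S`, target `T`, region `D`, weighting `W`, accuracy `δ`):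
with probability at least `P(≥ N contacts ∧ 𝒢) − 3δ` some candidate contact is selected with an open seed AND has a good relay in its face —
the conclusion of Kozma–Nitzan's Claim D ((26): `Σ_ξ p_ξ φ_ξ ≥ (1−3δ) P(𝒢)`) stated as an event inequality (on the many-contacts event, where
the selection has its Step-III properties).
[cite: KozmaNitzan2024, §4 pp. 21–22 ((24)–(26))] [this work] -/
def RelayClause (L : LData G) (W : Sym2 V → unitInterval) (j : ℕ) (σ : SData V) (S T D : Finset V) (δ : ℝ) : Prop :=
  (prodBernoulli W).real ((L.Fail σ.N j)ᶜ ∩ L.Gev σ j) - 3 * δ ≤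
    (prodBernoulli W).real (⋃ x ∈ σ.K, (L.oSeed σ j x ∩ GoodFace W σ S T D δ x))

/-- The relay clause is monotone in the accuracy. [folklore] -/
theorem RelayClause.mono {L : LData G} {W : Sym2 V → unitInterval} {j : ℕ} {σ : SData V} {S T D : Finset V} {δ δ' : ℝ}
    (h : RelayClause L W j σ S T D δ) (hδδ' : δ ≤ δ') : RelayClause L W j σ S T D δ' := by
  unfold RelayClause at h ⊢
  refine le_trans (by linarith) (h.trans (measureReal_mono ?_ (measure_ne_top _ _)))
  exact Set.iUnion₂_mono fun x _ => Set.inter_subset_inter_right _ (goodFace_mono W σ S T D hδδ' x)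

variable (W : Sym2 V → unitInterval) (p : unitInterval) (Δ : ℕ)

/-- **Kits at accuracy `δ`, (S0) shape**: the hypotheses of the (source-additive) target property at `δ` — level hypotheses, window inside
the depth, nonempty target inside `D`, enough levels for Step II, and at every level of the window Step-III seed data with the seed bound,
a shell `S ⊆ D` containing the faces, and the RELAY CLAUSE at `δ` (in place of `TStep.KitsAt`'s seeds-off-`E(S)` + Step-IV face estimate).
[cite: KozmaNitzan2024, §4 Lemma 10 (pp. 17–22)] [this work] -/
def TStep.KitsAtF (s : TStep G) (δ : ℝ) : Prop :=
  LHyp s.L W p s.D s.R ∧ s.j₁ ≤ s.R ∧ s.T ⊆ s.D ∧ s.T.Nonempty ∧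
    1 / (1 - (p : ℝ)) ^ (Δ * s.N) ≤ δ * ((Finset.Icc s.j₀ s.j₁).card : ℝ) ∧
    ∀ j ∈ Finset.Icc s.j₀ s.j₁, ∃ (σ : SData V) (S : Finset V), SHyp s.L j σ ∧ σ.N ≤ s.N ∧
      (1 - (p : ℝ) ^ σ.sB) ^ σ.k ≤ δ ∧ S ⊆ s.D ∧ (∀ x ∈ σ.K, σ.face x ⊆ S) ∧ RelayClause s.L W j σ S s.T s.D δ

variable {W p Δ}

omit [G.LocallyFinite] in
/-- **(S0)-kits at accuracy `δ` are (S0)-kits at every coarser accuracy `δ' ≥ δ`.** [folklore] -/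
theorem TStep.KitsAtF.mono [G.LocallyFinite] {s : TStep G} {δ δ' : ℝ} (h : s.KitsAtF W p Δ δ) (hδδ' : δ ≤ δ') :
    s.KitsAtF W p Δ δ' := by
  obtain ⟨hL, hj, hTD, hTne, hJ, hkits⟩ := h
  refine ⟨hL, hj, hTD, hTne, hJ.trans (mul_le_mul_of_nonneg_right hδδ' (Nat.cast_nonneg _)), fun j hjJ => ?_⟩
  obtain ⟨σ, S, hσ, hN, hIII, hSD, hUS, hV⟩ := hkits j hjJ
  exact ⟨σ, S, hσ, hN, hIII.trans hδδ', hSD, hUS, hV.mono hδδ'⟩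

/-! ## §2 The bridge: Kozma–Nitzan kits satisfy the relay clause -/

open Classical in
/-- **Claim D's independence half** (KN p. 21–22, (26)): if the seeds avoid the pairs inside the shell `S ⊆ B⟨j⟩` and every candidate contact
has the Step-IV face estimate `P(some u ∈ face x is a good relay) ≥ 1 − 3δ`, then the relay clause holds — `F_x` is determined by the pairs
OUTSIDE `E(S)` (`LData.determinedBy_Fx`), the good-relay event by the pairs INSIDE, so `P(F_x ∩ Good_x) = P(F_x)·P(Good_x)`, and the `F_x`
partition `𝒢`. [cite: KozmaNitzan2024, §4 pp. 21–22 ((26), "P_{K_ξ}(F_P) = P_G(F_P)")] -/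
theorem relayClause_of_stepIV {L : LData G} {W : Sym2 V → unitInterval} {j : ℕ} {σ : SData V} {S T D : Finset V}
    {δ : ℝ} (hδ : 0 ≤ δ) (hSX : S ⊆ L.X j) (hSseed : ∀ x ∈ σ.K, ∀ e ∈ σ.seed x, e ∉ wireSet (↑S : Set V))
    (hIV : ∀ x ∈ σ.K, 1 - 3 * δ ≤ (prodBernoulli W).real (GoodFace W σ S T D δ x)) :
    RelayClause L W j σ S T D δ := by
  set μ := prodBernoulli W with hμ
  unfold RelayClause
  -- `⋃ F_x ∩ Good_x ⊆ ⋃ oSeed_x ∩ Good_x`, the former a disjoint union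
  have hsub : (⋃ x ∈ σ.K, (L.Fx σ j x ∩ GoodFace W σ S T D δ x)) ⊆ ⋃ x ∈ σ.K, (L.oSeed σ j x ∩ GoodFace W σ S T D δ x) :=
    Set.iUnion₂_mono fun x _ => Set.inter_subset_inter_left _ (LData.Fx_subset_oSeed x)
  refine le_trans ?_ (measureReal_mono hsub (measure_ne_top _ _))
  have hdisj : (↑σ.K : Set V).PairwiseDisjoint fun x => L.Fx σ j x ∩ GoodFace W σ S T D δ x :=
    fun x hx x' hx' hne => (LData.Fx_disjoint hne (Finset.mem_coe.1 hx') (Finset.mem_coe.1 hx)).mono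
      Set.inter_subset_left Set.inter_subset_left
  rw [measureReal_biUnion_finset hdisj (fun x _ => (LData.measurableSet_Fx j x).inter (measurableSet_goodFace W σ S T D δ x))]
  -- independence per contact
  have hind : ∀ x ∈ σ.K, μ.real (L.Fx σ j x ∩ GoodFace W σ S T D δ x) = μ.real (L.Fx σ j x) * μ.real (GoodFace W σ S T D δ x) := by
    intro x hx
    rw [Set.inter_comm, mul_comm, hμ]
    refine prodBernoulli_real_inter_of_determinedBy W (pairsF S) (determinedBy_goodFace W σ S T D δ x) ?_
      (measurableSet_goodFace W σ S T D δ x) (LData.measurableSet_Fx j x)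
    rw [coe_pairsF]
    exact LData.determinedBy_Fx hSX hSseed hx
  have hG : μ.real (L.Gev σ j) = ∑ x ∈ σ.K, μ.real (L.Fx σ j x) := by
    rw [← LData.biUnion_Fx_eq_Gev, measureReal_biUnion_finset (LData.Fx_pairwiseDisjoint j) (fun x _ => LData.measurableSet_Fx j x)]
  have hGle : μ.real (L.Gev σ j) ≤ 1 := measureReal_le_one
  have hFG : μ.real ((L.Fail σ.N j)ᶜ ∩ L.Gev σ j) ≤ μ.real (L.Gev σ j) := measureReal_mono Set.inter_subset_right (measure_ne_top _ _)
  calc μ.real ((L.Fail σ.N j)ᶜ ∩ L.Gev σ j) - 3 * δ ≤ (1 - 3 * δ) * μ.real (L.Gev σ j) := by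
        nlinarith [measureReal_nonneg (μ := μ) (s := L.Gev σ j), hGle, hδ, hFG]
    _ = ∑ x ∈ σ.K, (1 - 3 * δ) * μ.real (L.Fx σ j x) := by rw [hG, Finset.mul_sum]
    _ ≤ ∑ x ∈ σ.K, μ.real (L.Fx σ j x) * μ.real (GoodFace W σ S T D δ x) := Finset.sum_le_sum fun x hx => by
        rw [mul_comm]; exact mul_le_mul_of_nonneg_left (hIV x hx) measureReal_nonneg
    _ = ∑ x ∈ σ.K, μ.real (L.Fx σ j x ∩ GoodFace W σ S T D δ x) := Finset.sum_congr rfl fun x hx => (hind x hx).symm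

omit [G.LocallyFinite] in
/-- **Kozma–Nitzan kits are (S0)-shape kits**: `TStep.KitsAt W p Δ δ → TStep.KitsAtF W p Δ δ` (`δ ≥ 0`). [this work] -/
theorem TStep.KitsAt.toF [G.LocallyFinite] {s : TStep G} {δ : ℝ} (hδ : 0 ≤ δ) (h : s.KitsAt W p Δ δ) : s.KitsAtF W p Δ δ := by
  obtain ⟨hL, hj, hTD, hTne, hJ, hkits⟩ := h
  refine ⟨hL, hj, hTD, hTne, hJ, fun j hjJ => ?_⟩
  obtain ⟨σ, S, hσ, hN, hIII, hSX, hSD, hSseed, hUS, hIV⟩ := hkits j hjJ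
  exact ⟨σ, S, hσ, hN, hIII, hSD, hUS, relayClause_of_stepIV hδ hSX hSseed hIV⟩

end Relay

/-! ## §3 The source-additive target property over the relay clause, and its additive chains -/

/-- **The SOURCE-ADDITIVE target property over (S0)-shape kits**, uniform in the parameter and the graph: there is an absolute `C ≥ 0` such that
for every kit accuracy `δ ∈ (0, 1]`, every `p < 1`, every graph on `V` with degrees `≤ Δ`, every level datum with the hypotheses of Kozma–Nitzan's
Lemma 10 whose per-level kits carry the RELAY CLAUSE at `δ` — and no hypothesis on the source — `P_W(o ↔ T) ≥ P_W(o ↔ B⟨0⟩) − C·δ`.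
(Binder list of `AdditiveTargetPropertyUP` with the per-level clause of `TStep.KitsAtF`.) [cite: KozmaNitzan2024, §4 Lemma 10 (pp. 17–22)] [this work] -/
def AdditiveTargetPropertyUF (V : Type) [DecidableEq V] (Δ : ℕ) : Prop :=
  ∃ C : ℝ, 0 ≤ C ∧ ∀ ⦃δ : ℝ⦄, 0 < δ → δ ≤ 1 → ∀ (p : unitInterval), (p : ℝ) < 1 →
    ∀ (G : SimpleGraph V) [G.LocallyFinite], (∀ x, G.degree x ≤ Δ) →
    ∀ (L : LData G) (W : Sym2 V → unitInterval) (D T : Finset V) (R N j₀ j₁ : ℕ),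
    LHyp L W p D R → j₁ ≤ R → T ⊆ D → T.Nonempty →
    1 / (1 - (p : ℝ)) ^ (Δ * N) ≤ δ * ((Finset.Icc j₀ j₁).card : ℝ) →
    (∀ j ∈ Finset.Icc j₀ j₁, ∃ (σ : SData V) (S : Finset V), SHyp L j σ ∧ σ.N ≤ N ∧
      (1 - (p : ℝ) ^ σ.sB) ^ σ.k ≤ δ ∧ S ⊆ D ∧ (∀ x ∈ σ.K, σ.face x ⊆ S) ∧ RelayClause L W j σ S T D δ) →
      (prodBernoulli W).real L.reachB - C * δ ≤ (prodBernoulli W).real (⋃ t ∈ T, openConn L.o t)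

variable {V : Type} [DecidableEq V]

namespace AdditiveTargetPropertyUF

/-- **The (S0)-shape property implies the Kozma–Nitzan-shape one** (through the bridge `TStep.KitsAt.toF`'s per-level argument), hence also the
bundled `TargetPropertyUP`. [this work] -/
theorem toUP {Δ : ℕ} (hA : AdditiveTargetPropertyUF V Δ) : AdditiveTargetPropertyUP V Δ := by
  obtain ⟨C, hC0, h⟩ := hA
  refine ⟨C, hC0, fun δ hδ hδ1 p hp1 G _ hΔ L W D T R N j₀ j₁ hL hj hTD hTne hJ hkits => ?_⟩
  refine h hδ hδ1 p hp1 G hΔ L W D T R N j₀ j₁ hL hj hTD hTne hJ fun j hjJ => ?_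
  obtain ⟨σ, S, hσ, hN, hIII, hSX, hSD, hSseed, hUS, hIV⟩ := hkits j hjJ
  exact ⟨σ, S, hσ, hN, hIII, hSD, hUS, relayClause_of_stepIV hδ.le hSX hSseed hIV⟩

/-- **One application to a `TStep` with (S0)-shape kits**, source-additive: `P(o ↔ T) ≥ P(o ↔ X 0) − C·δ`.
[cite: KozmaNitzan2024, §4 Lemma 10 (p. 17)] [this work] -/
theorem apply_step {Δ : ℕ} (hA : AdditiveTargetPropertyUF V Δ) :
    ∃ C : ℝ, 0 ≤ C ∧ ∀ ⦃δ : ℝ⦄, 0 < δ → δ ≤ 1 → ∀ (p : unitInterval), (p : ℝ) < 1 →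
      ∀ (G : SimpleGraph V) [G.LocallyFinite], (∀ x, G.degree x ≤ Δ) →
      ∀ (W : Sym2 V → unitInterval) (s : TStep G), s.KitsAtF W p Δ δ →
        (prodBernoulli W).real s.L.reachB - C * δ ≤ (prodBernoulli W).real (⋃ t ∈ s.T, openConn s.L.o t) := by
  obtain ⟨C, hC0, h⟩ := hA
  refine ⟨C, hC0, fun δ hδ hδ1 p hp1 G _ hΔ W s hk => ?_⟩
  obtain ⟨hL, hj, hTD, hTne, hJ, hkits⟩ := hk
  exact h hδ hδ1 p hp1 G hΔ s.L W s.D s.T s.R s.N s.j₀ s.j₁ hL hj hTD hTne hJ hkits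

/-- **ADDITIVE CHAINS with enlarged targets over (S0)-shape kits**: for a chain `s₀, …, s_n` with a common source, true targets `T'_i ⊆ T_i`
linked by `T'_i ⊆ X_{i+1}(0)`, (S0)-kits at accuracy `δ ∈ (0, 1]` on every step and excess `P_W(o ↔ T_i \ T'_i) ≤ η`:
`P_W(o ↔ X_0(0)) − (n + 1)·(C·δ + η) ≤ P_W(o ↔ T'_n)`.  (Proof verbatim from `AdditiveTargetPropertyUP.chain_edge_additive`.)
[cite: KozmaNitzan2024, §4 Lemma 11 (p. 22), Lemma 12 (pp. 23–25)] [this work] -/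
theorem chain_edge_additive {Δ : ℕ} (hA : AdditiveTargetPropertyUF V Δ) :
    ∃ C : ℝ, 0 ≤ C ∧ ∀ (n : ℕ) ⦃δ : ℝ⦄, 0 < δ → δ ≤ 1 → ∀ (p : unitInterval), (p : ℝ) < 1 →
      ∀ (G : SimpleGraph V) [G.LocallyFinite], (∀ x, G.degree x ≤ Δ) →
      ∀ (W : Sym2 V → unitInterval) (s : Fin (n + 1) → TStep G) (T' : Fin (n + 1) → Finset V) (η : ℝ),
      (∀ i : Fin (n + 1), (s i).L.o = (s 0).L.o) →
      (∀ i : Fin n, T' (Fin.castSucc i) ⊆ (s i.succ).L.X 0) →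
      (∀ i : Fin (n + 1), T' i ⊆ (s i).T) →
      (∀ i : Fin (n + 1), (s i).KitsAtF W p Δ δ) →
      (∀ i : Fin (n + 1), (prodBernoulli W).real (⋃ t ∈ (s i).T \ T' i, openConn (s 0).L.o t) ≤ η) →
        (prodBernoulli W).real (s 0).L.reachB - (n + 1 : ℕ) * (C * δ + η) ≤
          (prodBernoulli W).real (⋃ t ∈ T' (Fin.last n), openConn (s 0).L.o t) := by
  obtain ⟨C, hC0, hstep⟩ := hA.apply_step
  refine ⟨C, hC0, fun n => ?_⟩
  induction n with
  | zero =>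
    intro δ hδ hδ1 p hp1 G _ hΔ W s T' η _ _ hsub hk hexc
    have h1 := hstep hδ hδ1 p hp1 G hΔ W (s 0) (hk 0)
    have h2 := real_biUnion_openConn_le_add_sdiff (prodBernoulli W) (s 0).L.o (hsub 0)
    have h3 := hexc 0
    show (prodBernoulli W).real (s 0).L.reachB - (0 + 1 : ℕ) * (C * δ + η) ≤ (prodBernoulli W).real (⋃ t ∈ T' 0, openConn (s 0).L.o t)
    push_cast
    linarith
  | succ n ih =>
    intro δ hδ hδ1 p hp1 G _ hΔ W s T' η ho hlink hsub hk hexc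
    -- the truncated chain
    set s' : Fin (n + 1) → TStep G := fun i => s (Fin.castSucc i) with hs'
    set T'' : Fin (n + 1) → Finset V := fun i => T' (Fin.castSucc i) with hT''
    have ho' : ∀ i : Fin (n + 1), (s' i).L.o = (s' 0).L.o := fun i => by
      simp only [hs']; rw [ho (Fin.castSucc i)]; exact (ho (Fin.castSucc 0)).symm
    have h0 : (s' 0).L.o = (s 0).L.o := rfl
    have hlink' : ∀ i : Fin n, T'' (Fin.castSucc i) ⊆ (s' i.succ).L.X 0 := fun i => by
      simp only [hs', hT'']
      have := hlink (Fin.castSucc i)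
      have e : (Fin.castSucc i).succ = Fin.castSucc i.succ := Fin.ext (by simp)
      rwa [e] at this
    have hsub' : ∀ i : Fin (n + 1), T'' i ⊆ (s' i).T := fun i => hsub (Fin.castSucc i)
    have hk' : ∀ i : Fin (n + 1), (s' i).KitsAtF W p Δ δ := fun i => hk (Fin.castSucc i)
    have hexc' : ∀ i : Fin (n + 1), (prodBernoulli W).real (⋃ t ∈ (s' i).T \ T'' i, openConn (s' 0).L.o t) ≤ η := fun i => by
      rw [h0]; exact hexc (Fin.castSucc i)
    have hmid := ih hδ hδ1 p hp1 G hΔ W s' T'' η ho' hlink' hsub' hk' hexc'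
    have hs0 : (s' 0) = s 0 := rfl
    rw [hs0] at hmid
    -- `T'_n ⊆ X_{n+1}(0)`: the last step's level zero is reached at least as often as `T'_n`
    have hlastlink : T'' (Fin.last n) ⊆ (s (Fin.last (n + 1))).L.X 0 := by
      have := hlink (Fin.last n)
      simp only [hT'']
      rwa [Fin.succ_last] at this
    have holast : (s (Fin.last (n + 1))).L.o = (s 0).L.o := ho _
    have hsubB : (⋃ t ∈ T'' (Fin.last n), openConn (s 0).L.o t) ⊆ (s (Fin.last (n + 1))).L.reachB := by
      intro ω hω
      simp only [Set.mem_iUnion, exists_prop] at hω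
      obtain ⟨t, ht, hωt⟩ := hω
      unfold LData.reachB
      rw [holast]
      exact Set.mem_biUnion (Finset.mem_coe.2 (hlastlink ht)) hωt
    have hreachLast : (prodBernoulli W).real (⋃ t ∈ T'' (Fin.last n), openConn (s 0).L.o t) ≤
        (prodBernoulli W).real (s (Fin.last (n + 1))).L.reachB := measureReal_mono hsubB (measure_ne_top _ _)
    have h1 := hstep hδ hδ1 p hp1 G hΔ W (s (Fin.last (n + 1))) (hk _)
    rw [holast] at h1
    have h2 := real_biUnion_openConn_le_add_sdiff (prodBernoulli W) (s 0).L.o (hsub (Fin.last (n + 1)))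
    have h3 := hexc (Fin.last (n + 1))
    push_cast at hmid ⊢
    nlinarith

/-- **The shape a closure consumes**: source at confidence `1 − δs`, (S0)-kits at `δ`, excess `≤ η` ⟹ conclusion at
`1 − (δs + (n+1)(C·δ + η))`. [this work] -/
theorem chain_edge_from_source {Δ : ℕ} (hA : AdditiveTargetPropertyUF V Δ) :
    ∃ C : ℝ, 0 ≤ C ∧ ∀ (n : ℕ) ⦃δ : ℝ⦄, 0 < δ → δ ≤ 1 → ∀ (δs : ℝ) (p : unitInterval), (p : ℝ) < 1 →
      ∀ (G : SimpleGraph V) [G.LocallyFinite], (∀ x, G.degree x ≤ Δ) →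
      ∀ (W : Sym2 V → unitInterval) (s : Fin (n + 1) → TStep G) (T' : Fin (n + 1) → Finset V) (η : ℝ),
      (∀ i : Fin (n + 1), (s i).L.o = (s 0).L.o) →
      (∀ i : Fin n, T' (Fin.castSucc i) ⊆ (s i.succ).L.X 0) →
      (∀ i : Fin (n + 1), T' i ⊆ (s i).T) →
      (∀ i : Fin (n + 1), (s i).KitsAtF W p Δ δ) →
      (∀ i : Fin (n + 1), (prodBernoulli W).real (⋃ t ∈ (s i).T \ T' i, openConn (s 0).L.o t) ≤ η) →
      1 - δs < (prodBernoulli W).real (s 0).L.reachB →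
        1 - (δs + (n + 1 : ℕ) * (C * δ + η)) < (prodBernoulli W).real (⋃ t ∈ T' (Fin.last n), openConn (s 0).L.o t) := by
  obtain ⟨C, hC0, h⟩ := hA.chain_edge_additive
  refine ⟨C, hC0, fun n δ hδ hδ1 δs p hp1 G _ hΔ W s T' η ho hlink hsub hk hexc hsrc => ?_⟩
  have := h n hδ hδ1 p hp1 G hΔ W s T' η ho hlink hsub hk hexc
  linarith

end AdditiveTargetPropertyUF

end KNLevels

end Transplant

end Summit.CriticalPhenomena.PercolationContinuityZ3.Theorems

end
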